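import Summits.ResolutionOfSingularities.ResolutionOfSingularities.Theorems.HilbertSamuelEliminationSigmaMaxModificationsCorridor3SigmaMenuSurfacePrep
import HarnessLib

/-!
# [OURS · L1 W4.2] σ-LAYER — `Corridor3SigmaMenuGate`: THE GROUP GATE as ONE policy parameter (res-L1-w42-plan-1 RULINGS v3.14-37 (JB)(5)(d-γ) /
# (JE)(b) and v3.14-38 (JI)/(JJ)): centre gates, GATED site proposals, the gate «every live group corner on the centre lets it pass» with its
# three-way shape (exact ↦ Q-discipline, tame ↦ adaptedness, wild ↦ no gate), and the GATED (P1) surface phase; crux chain w42 `SigmaMaxModifications`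
# stmt-ResolutionOfSingularities-18506 / conjunct `SigmaMaxModificationsCorridor3` stmt-ResolutionOfSingularities-19249

OURS (cell res-hironaka, slot W4.2; typer res-L1-type-o1 g9, file 6 of the σ-layer menu files); NOT statements of H. Hironaka's manuscript [Hironaka2017] nor of
[CossartJannsenSaito2020]; AI-typed, weaker than expert review. Helper VOCABULARY `--supports stmt-ResolutionOfSingularities-19249 --as helper` (counted 0).
Additive over `…SigmaMenuScheduler` (p533524: `SiteProposal`, `IsLiveSite`, `StrategyE.oldestFirst`), `…SigmaMenuSurfacePhase` (p540556: `surfaceProposal`,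
`StrategyE.surfacePhase`, `policyOfRecord`) and `…SigmaMenuSurfacePrep` (p543457/p544886).

## The design sentence typed here (RULING v3.14-38 (JI), one parameter per (JJ); face clause per -39 (JO)/(KR′))

«At every LIVE GROUP CORNER the group's OWN discipline gates every global proposal ((P1) / PHASE S / B′ centres, (P2′) sites) whose centre passes through the
corner — EXACT corner: Q-admissibility (RULING -37 (JB)); TAME corner: (N, S(q))-adaptedness; WILD corner: no kind gate; and for EVERY kind a centre through a
live corner's point that is not a MEMBER FACE there is blocked. A blocked proposal is SKIPPED this cycle (the tier falls through), never queued inside a cycle.»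

* §1 `CentreGate`, `SiteProposal.gated ρ G` (proposal ∧ gate): a blocked proposal is NOT LIVE (`isLiveSite_gated_iff`), so `oldestFirst (ρ.gated G) κ` serves
  the oldest UNBLOCKED live site and is silent iff every live site is blocked (fall-through; `betweenCycles` atomicity untouched — gating only removes steps);
  every served centre PASSES (`oldestFirst_gated_passes`); discipline / functionality inherited.
* §2 `CornerReading` (live group corners' points), `GroupGate` («`C` passes the discipline of the live corner at `g`»), **`CentreGate.ofCorners corners γ`**
  («every live corner on `V(C)` lets `C` pass»; centres missing all live corners pass — res-type-067's `prepCentre_disjoint_liveExactCorners` feeds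
  `ofCorners_of_forall_not_mem`), `CornerKind`, **`GroupGate.byKind kind γe γt`** (exact ↦ `γe`, tame ↦ `γt`, wild ↦ pass), `GroupGate.withFace face γ` and
  **`GroupGate.ofRecordShape face kind γe γt := withFace face (byKind kind γe γt)`** — instances BY NAME: `face` := «`V(C)` is a member face at `g`» (corner
  model), `γe` := res-D-pv-060's `QAllowed` through `…SigmaFaceIdentification` (k = 3) / (d-δ) Q₂ (k = 2) with res-D-pv-002's reading, `γt` := idea-2's `Adapted`.
* §3 **`StrategyE.surfacePhaseGated Ready prep G := oldestFirst ((surfaceProposal Ready prep).gated G) unitKey`** with `_isFunctional`, `_step_spec`, `_passes`,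
  `_step_pending_eq_none`, `_isStratumDisciplined (hReady) (hprep)`, `_top` (trivial gate = `surfacePhase`); §4 the gated tier OF RECORD
  `surfacePhaseOfRecordGated` (over `SurfacePrep.ofRecord`) and the assembly corollary — `policyOfRecord` keeps its shape (π₁ := gated (P1), π₂ := a gated
  curve phase `oldestFirst (ρ₂.gated G) κ₂`, π₃ := `groupService γ Ω`).
-/

noncomputable section

set_option linter.dupNamespace false -- mandated namespace of this single-conjunct summit

open CategoryTheory AlgebraicGeometry TopologicalSpace
open Summit.ResolutionOfSingularities.ResolutionOfSingularities.Theorems.CampaignW42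
open Literature.AlgebraicGeometry.Resolution Literature.RingTheory.HilbertSamuel

namespace Summit.ResolutionOfSingularities.ResolutionOfSingularities.Theorems.SigmaMaxModificationsCorridor3.Sigma

universe u

/-! ## §1. Centre gates and gated site proposals -/

/-- [OURS · L1 W4.2] **A CENTRE GATE**: «at the state `(W, L, P, E)`, level `N`, value `ν`, the proposed centre `C` PASSES». NOT a statement of the
manuscript. [folklore] -/
abbrev CentreGate : Type (u + 1) :=
  ∀ (W : Scheme.{u}), IsLocallyNoetherian W → ℕ → (ℕ → ℕ) → Labelling W → Option (Pending W) → Boundary W → W.IdealSheafData → Prop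

/-- [OURS · L1 W4.2] The trivial gate (everything passes). [folklore] -/
def CentreGate.top : CentreGate.{u} :=
  fun _ _ _ _ _ _ _ _ => True

/-- [OURS · L1 W4.2] **GATED PROPOSALS**: `ρ.gated G` proposes `(C, P')` at `x` iff `ρ` does AND `C` passes the gate. NOT a statement of the manuscript.
[folklore] -/
def SiteProposal.gated (ρ : SiteProposal.{u}) (G : CentreGate.{u}) : SiteProposal.{u} :=
  fun W hW N ν L P E x C P' => ρ W hW N ν L P E x C P' ∧ G W hW N ν L P E C

section Gated

variable {K : Type} {ρ : SiteProposal.{u}} {G : CentreGate.{u}} {κ : SiteKey.{u} K} {M : CentreMenu.{u}} {N : ℕ} {ν : ℕ → ℕ}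
  {W : Scheme.{u}} {hW : IsLocallyNoetherian W} {L : Labelling W} {P : Option (Pending W)} {E : Boundary W} {x : W}
  {C : W.IdealSheafData} {P' : Option (Pending (blowup C))}

/-- Unfolding (`Iff.rfl`). [folklore] -/
@[simp] theorem SiteProposal.gated_iff :
    ρ.gated G W hW N ν L P E x C P' ↔ ρ W hW N ν L P E x C P' ∧ G W hW N ν L P E C :=
  Iff.rfl

/-- A gated proposal is a proposal. [folklore] -/
theorem SiteProposal.gated_le (h : ρ.gated G W hW N ν L P E x C P') : ρ W hW N ν L P E x C P' :=
  h.1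

/-- A gated proposal passes the gate. [folklore] -/
theorem SiteProposal.gated_passes (h : ρ.gated G W hW N ν L P E x C P') : G W hW N ν L P E C :=
  h.2

/-- The trivial gate changes nothing. [folklore] -/
@[simp] theorem SiteProposal.gated_top (ρ : SiteProposal.{u}) : ρ.gated CentreGate.top = ρ := by
  funext W hW N ν L P E x C P'
  exact propext ⟨fun h => h.1, fun h => ⟨h, trivial⟩⟩

/-- **A site is live for the gated proposals iff it lies in the stratum and has an UNBLOCKED proposal** (a site all of whose proposals are blocked is
not live: it is SKIPPED). [folklore] -/
theorem isLiveSite_gated_iff :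
    IsLiveSite (ρ.gated G) W hW N ν L P E x ↔
      x ∈ Scheme.hsStratum W N ν ∧ ∃ (C : W.IdealSheafData) (P' : Option (Pending (blowup C))), ρ W hW N ν L P E x C P' ∧ G W hW N ν L P E C :=
  Iff.rfl

/-- A live site of the gated proposals is a live site of the proposals. [folklore] -/
theorem IsLiveSite.of_gated (h : IsLiveSite (ρ.gated G) W hW N ν L P E x) : IsLiveSite ρ W hW N ν L P E x :=
  ⟨h.1, let ⟨C, P', hρ, _⟩ := h.2; ⟨C, P', hρ⟩⟩

/-- **Every step of the gated oldest-first phase is an unblocked proposal at an oldest unblocked live site.** [folklore] -/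
theorem StrategyE.oldestFirst_gated_step_spec [LE K] (hs : (StrategyE.oldestFirst (ρ.gated G) κ).step W hW N ν L P E C P') :
    ∃ x : W, IsOldestLiveSite (ρ.gated G) κ W hW N ν L P E x ∧ ρ W hW N ν L P E x C P' ∧ G W hW N ν L P E C := by
  obtain ⟨x, hx, hρ, hg⟩ := StrategyE.oldestFirst_step_spec hs
  exact ⟨x, hx, hρ, hg⟩

/-- **THE POINT OF THE GATE: every centre the gated phase serves PASSES.** [folklore] -/
theorem StrategyE.oldestFirst_gated_passes [LE K] (hs : (StrategyE.oldestFirst (ρ.gated G) κ).step W hW N ν L P E C P') :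
    G W hW N ν L P E C := by
  obtain ⟨-, -, -, hg⟩ := StrategyE.oldestFirst_gated_step_spec hs
  exact hg

/-- **The gated phase speaks iff some oldest UNBLOCKED live site exists**; for a well-founded key (ages, the unit key) iff some unblocked live site
exists (`HasLiveSite.hasOldestLiveSite`) — otherwise it is SILENT and the hybrid falls through to the next tier. [folklore] -/
theorem StrategyE.oldestFirst_gated_exists_step_iff [LinearOrder K] [WellFoundedLT K] :
    (∃ (C : W.IdealSheafData) (P' : Option (Pending (blowup C))), (StrategyE.oldestFirst (ρ.gated G) κ).step W hW N ν L P E C P') ↔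
      HasLiveSite (ρ.gated G) W hW N ν L P E :=
  StrategyE.oldestFirst_exists_step_iff.trans ⟨HasOldestLiveSite.hasLiveSite, HasLiveSite.hasOldestLiveSite⟩

/-- **Discipline is inherited**: if the proposals are menu centres at stratum sites, so is every step of the gated phase. [folklore] -/
theorem StrategyE.oldestFirst_gated_isDisciplinedBy [LE K]
    (hρM : ∀ (W : Scheme.{u}) (hW : IsLocallyNoetherian W) (L : Labelling W) (P : Option (Pending W)) (E : Boundary W) (x : W)
      (C : W.IdealSheafData) (P' : Option (Pending (blowup C))), x ∈ Scheme.hsStratum W N ν → ρ W hW N ν L P E x C P' → M W E N ν x C) :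
    (StrategyE.oldestFirst (ρ.gated G) κ).IsDisciplinedBy M N ν :=
  StrategyE.oldestFirst_isDisciplinedBy fun W hW L P E x C P' hx h => hρM W hW L P E x C P' hx h.1

end Gated

/-! ## §2. Group gates at live corners: the gate of record's shape -/

/-- [OURS · L1 W4.2] **A CORNER READING**: the set of (points of) LIVE GROUP CORNERS at the state (instance: the live exact / tame / wild group corners of
the corner model, res-type-067 / res-D-pv-002). NOT a statement of the manuscript. [folklore] -/
abbrev CornerReading : Type (u + 1) :=
  ∀ (W : Scheme.{u}), IsLocallyNoetherian W → ℕ → (ℕ → ℕ) → Labelling W → Option (Pending W) → Boundary W → Set W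

/-- [OURS · L1 W4.2] **A GROUP GATE**: «at the state, the centre `C` passes the OWN DISCIPLINE of the live group corner at `g`». NOT a statement of the
manuscript. [folklore] -/
abbrev GroupGate : Type (u + 1) :=
  ∀ (W : Scheme.{u}), IsLocallyNoetherian W → ℕ → (ℕ → ℕ) → Labelling W → Option (Pending W) → Boundary W → W → W.IdealSheafData → Prop

/-- [OURS · L1 W4.2] **THE GATE OF RECORD'S SHAPE** (RULING v3.14-38 (JI)/(JJ)): `C` passes iff EVERY live group corner lying on `V(C)` lets it pass.
NOT a statement of the manuscript. [folklore] -/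
def CentreGate.ofCorners (corners : CornerReading.{u}) (γ : GroupGate.{u}) : CentreGate.{u} :=
  fun W hW N ν L P E C => ∀ g ∈ corners W hW N ν L P E, g ∈ (C.support : Set W) → γ W hW N ν L P E g C

section Corners

variable {corners corners₁ corners₂ : CornerReading.{u}} {γ γ₁ γ₂ : GroupGate.{u}} {N : ℕ} {ν : ℕ → ℕ} {W : Scheme.{u}}
  {hW : IsLocallyNoetherian W} {L : Labelling W} {P : Option (Pending W)} {E : Boundary W} {C : W.IdealSheafData}

/-- Unfolding (`Iff.rfl`). [folklore] -/
theorem CentreGate.ofCorners_iff :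
    CentreGate.ofCorners corners γ W hW N ν L P E C ↔ ∀ g ∈ corners W hW N ν L P E, g ∈ (C.support : Set W) → γ W hW N ν L P E g C :=
  Iff.rfl

/-- **A centre MISSING every live corner passes** (PHASE S centres ⊆ Sing D miss exact corners: res-type-067's `prepCentre_disjoint_liveExactCorners`;
non-snc POINT centres likewise, RULING -37 (JE)(c)). [folklore] -/
theorem CentreGate.ofCorners_of_forall_not_mem (h : ∀ g ∈ corners W hW N ν L P E, g ∉ (C.support : Set W)) :
    CentreGate.ofCorners corners γ W hW N ν L P E C :=
  fun g hg hgC => absurd hgC (h g hg)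

/-- Monotone in the group gate. [folklore] -/
theorem CentreGate.ofCorners_mono (hγ : ∀ (g : W) (C : W.IdealSheafData), γ₁ W hW N ν L P E g C → γ₂ W hW N ν L P E g C)
    (h : CentreGate.ofCorners corners γ₁ W hW N ν L P E C) : CentreGate.ofCorners corners γ₂ W hW N ν L P E C :=
  fun g hg hgC => hγ g C (h g hg hgC)

/-- Antitone in the corner reading (fewer live corners, fewer tests). [folklore] -/
theorem CentreGate.ofCorners_anti (hc : corners₁ W hW N ν L P E ⊆ corners₂ W hW N ν L P E)
    (h : CentreGate.ofCorners corners₂ γ W hW N ν L P E C) : CentreGate.ofCorners corners₁ γ W hW N ν L P E C :=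
  fun g hg hgC => h g (hc hg) hgC

/-- The passed centre passes at each live corner on it (the form the blocking group's service argument consumes). [folklore] -/
theorem CentreGate.ofCorners_apply (h : CentreGate.ofCorners corners γ W hW N ν L P E C) {g : W} (hg : g ∈ corners W hW N ν L P E)
    (hgC : g ∈ (C.support : Set W)) : γ W hW N ν L P E g C :=
  h g hg hgC

end Corners

/-- [OURS · L1 W4.2] **CORNER KINDS** (RULING v3.14-38 (JI)): exact (monomial), tame (`p ∤ m` cell), wild (residual of record). [folklore] -/
inductive CornerKind : Type
  /-- an EXACT (monomial) group corner — gated by Q-admissibility -/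
  | exact
  /-- a TAME corner — gated by `(N, S(q))`-adaptedness -/
  | tame
  /-- a WILD corner — no gate (residual of record) -/
  | wild
  deriving DecidableEq

/-- [OURS · L1 W4.2] **A CORNER-KIND READING**: the kind of the group corner at `g` at the state. NOT a statement of the manuscript. [folklore] -/
abbrev CornerKindReading : Type (u + 1) :=
  ∀ (W : Scheme.{u}), IsLocallyNoetherian W → ℕ → (ℕ → ℕ) → Labelling W → Option (Pending W) → Boundary W → W → CornerKind

/-- [OURS · L1 W4.2] The proposition a kind assigns: `γe` at exact corners, `γt` at tame corners, `True` at wild corners. [folklore] -/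
def CornerKind.gate (γe γt : Prop) : CornerKind → Prop
  | .exact => γe
  | .tame => γt
  | .wild => True

/-- [OURS · L1 W4.2] **THE THREE-WAY GROUP GATE** (RULING v3.14-38 (JI)): at an EXACT corner consult `γe` (Q-admissibility of the face `V(C)` cuts in the
corner chart), at a TAME corner consult `γt` (adaptedness), at a WILD corner let everything pass. NOT a statement of the manuscript. [folklore] -/
def GroupGate.byKind (kind : CornerKindReading.{u}) (γe γt : GroupGate.{u}) : GroupGate.{u} :=
  fun W hW N ν L P E g C => (kind W hW N ν L P E g).gate (γe W hW N ν L P E g C) (γt W hW N ν L P E g C)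

section ByKind

variable {kind : CornerKindReading.{u}} {γe γt : GroupGate.{u}} {N : ℕ} {ν : ℕ → ℕ} {W : Scheme.{u}} {hW : IsLocallyNoetherian W}
  {L : Labelling W} {P : Option (Pending W)} {E : Boundary W} {g : W} {C : W.IdealSheafData}

/-- At an exact corner the gate is `γe`. [folklore] -/
theorem GroupGate.byKind_of_exact (h : kind W hW N ν L P E g = .exact) :
    GroupGate.byKind kind γe γt W hW N ν L P E g C ↔ γe W hW N ν L P E g C := by
  simp [GroupGate.byKind, CornerKind.gate, h]

/-- At a tame corner the gate is `γt`. [folklore] -/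
theorem GroupGate.byKind_of_tame (h : kind W hW N ν L P E g = .tame) :
    GroupGate.byKind kind γe γt W hW N ν L P E g C ↔ γt W hW N ν L P E g C := by
  simp [GroupGate.byKind, CornerKind.gate, h]

/-- At a wild corner everything passes. [folklore] -/
theorem GroupGate.byKind_of_wild (h : kind W hW N ν L P E g = .wild) : GroupGate.byKind kind γe γt W hW N ν L P E g C := by
  simp [GroupGate.byKind, CornerKind.gate, h]

/-- [OURS · L1 W4.2] A group gate WITH A FACE TEST in front: `C` passes at `g` iff `V(C)` is a member face at `g` AND `γ` lets it pass (RULING v3.14-39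
(JO)/(KR′): for EVERY kind, a centre through a live corner's point that is not a member face there is blocked). NOT a statement of the manuscript. [folklore] -/
def GroupGate.withFace (face γ : GroupGate.{u}) : GroupGate.{u} :=
  fun W hW N ν L P E g C => face W hW N ν L P E g C ∧ γ W hW N ν L P E g C

/-- [OURS · L1 W4.2] **THE GROUP GATE OF RECORD'S SHAPE**: member-face test, then the kind's own discipline. NOT a statement of the manuscript. [folklore] -/
def GroupGate.ofRecordShape (face : GroupGate.{u}) (kind : CornerKindReading.{u}) (γe γt : GroupGate.{u}) : GroupGate.{u} :=
  GroupGate.withFace face (GroupGate.byKind kind γe γt)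

/-- Unfolding (`Iff.rfl`). [folklore] -/
@[simp] theorem GroupGate.withFace_iff {face γ : GroupGate.{u}} :
    GroupGate.withFace face γ W hW N ν L P E g C ↔ face W hW N ν L P E g C ∧ γ W hW N ν L P E g C :=
  Iff.rfl

/-- A non-face centre is blocked, whatever the kind. [folklore] -/
theorem GroupGate.ofRecordShape_face {face : GroupGate.{u}} (h : GroupGate.ofRecordShape face kind γe γt W hW N ν L P E g C) :
    face W hW N ν L P E g C :=
  h.1

/-- At an exact corner: face test and `γe`. [folklore] -/
theorem GroupGate.ofRecordShape_of_exact {face : GroupGate.{u}} (h : kind W hW N ν L P E g = .exact) :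
    GroupGate.ofRecordShape face kind γe γt W hW N ν L P E g C ↔ face W hW N ν L P E g C ∧ γe W hW N ν L P E g C := by
  simp [GroupGate.ofRecordShape, GroupGate.byKind_of_exact h]

/-- At a tame corner: face test and `γt`. [folklore] -/
theorem GroupGate.ofRecordShape_of_tame {face : GroupGate.{u}} (h : kind W hW N ν L P E g = .tame) :
    GroupGate.ofRecordShape face kind γe γt W hW N ν L P E g C ↔ face W hW N ν L P E g C ∧ γt W hW N ν L P E g C := by
  simp [GroupGate.ofRecordShape, GroupGate.byKind_of_tame h]

/-- At a wild corner: the face test only. [folklore] -/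
theorem GroupGate.ofRecordShape_of_wild {face : GroupGate.{u}} (h : kind W hW N ν L P E g = .wild) :
    GroupGate.ofRecordShape face kind γe γt W hW N ν L P E g C ↔ face W hW N ν L P E g C := by
  simp [GroupGate.ofRecordShape, GroupGate.byKind_of_wild h]

end ByKind

/-! ## §3. The GATED (P1) surface phase -/

section Surface

variable (Ready : SurfaceReadiness.{u}) (prep : SurfacePrep.{u}) (G : CentreGate.{u}) {N : ℕ} {ν : ℕ → ℕ}

/-- [OURS · L1 W4.2] **THE GATED (P1) SURFACE PHASE**: oldest-first over the GATED surface proposals — a surface proposal whose centre is blocked at some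
live group corner on it is skipped this cycle. NOT a statement of the manuscript. [folklore] -/
def StrategyE.surfacePhaseGated : StrategyE.{u} :=
  StrategyE.oldestFirst ((surfaceProposal Ready prep).gated G) unitKey

/-- Unfolding. [folklore] -/
theorem StrategyE.surfacePhaseGated_eq :
    StrategyE.surfacePhaseGated Ready prep G = StrategyE.oldestFirst ((surfaceProposal Ready prep).gated G) unitKey :=
  rfl

/-- **The trivial gate gives back the (P1) phase of `…SigmaMenuSurfacePhase`.** [folklore] -/
@[simp] theorem StrategyE.surfacePhaseGated_top : StrategyE.surfacePhaseGated Ready prep CentreGate.top = StrategyE.surfacePhase Ready prep := by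
  rw [StrategyE.surfacePhaseGated_eq, SiteProposal.gated_top, StrategyE.surfacePhase_eq]

/-- The gated phase is functional. [folklore] -/
theorem StrategyE.surfacePhaseGated_isFunctional (N : ℕ) (ν : ℕ → ℕ) : (StrategyE.surfacePhaseGated Ready prep G).IsFunctional N ν :=
  StrategyE.oldestFirst_isFunctional _ _ N ν

variable {Ready prep G}

/-- **Every step of the gated (P1) phase is an unblocked surface proposal at a stratum point**: a 2-dimensional stratum component `D` through the site,
`P' = none`, and either `D` is ready and `C = menuCentre D`, or `D` is not ready and `C` is a prep centre through the site; and `C` PASSES the gate.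
[folklore] -/
theorem StrategyE.surfacePhaseGated_step_spec {W : Scheme.{u}} {hW : IsLocallyNoetherian W} {L : Labelling W} {P : Option (Pending W)}
    {E : Boundary W} {C : W.IdealSheafData} {P' : Option (Pending (blowup C))}
    (hs : (StrategyE.surfacePhaseGated Ready prep G).step W hW N ν L P E C P') :
    ∃ (x : W) (D : Closeds W), x ∈ Scheme.hsStratum W N ν ∧ (D : Set W) ∈ surfaceComponents W N ν ∧ x ∈ (D : Set W) ∧ P' = none ∧
      ((Ready W E N ν D ∧ C = menuCentre D) ∨ (¬ Ready W E N ν D ∧ prep W hW N ν L P E D C ∧ x ∈ (C.support : Set W))) ∧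
        G W hW N ν L P E C := by
  obtain ⟨x, ⟨⟨hx, -⟩, -⟩, ⟨D, hD, hxD, hP', h⟩, hg⟩ := StrategyE.oldestFirst_gated_step_spec hs
  exact ⟨x, D, hx, hD, hxD, hP', h, hg⟩

/-- Every centre the gated (P1) phase serves passes the gate. [folklore] -/
theorem StrategyE.surfacePhaseGated_passes {W : Scheme.{u}} {hW : IsLocallyNoetherian W} {L : Labelling W} {P : Option (Pending W)}
    {E : Boundary W} {C : W.IdealSheafData} {P' : Option (Pending (blowup C))}
    (hs : (StrategyE.surfacePhaseGated Ready prep G).step W hW N ν L P E C P') : G W hW N ν L P E C :=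
  StrategyE.oldestFirst_gated_passes hs

/-- Gated (P1) steps leave no CJS cycle pending: `P' = none`. [folklore] -/
theorem StrategyE.surfacePhaseGated_step_pending_eq_none {W : Scheme.{u}} {hW : IsLocallyNoetherian W} {L : Labelling W} {P : Option (Pending W)}
    {E : Boundary W} {C : W.IdealSheafData} {P' : Option (Pending (blowup C))}
    (hs : (StrategyE.surfacePhaseGated Ready prep G).step W hW N ν L P E C P') : P' = none := by
  obtain ⟨-, -, -, -, -, hP', -⟩ := StrategyE.surfacePhaseGated_step_spec hs
  exact hP'

/-- **THE GATED (P1) PHASE IS STRATUM-DISCIPLINED** under the same two obligations as the ungated one (ready components have regular reduced structure;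
prep centres are regular inside the stratum) — the gate only removes steps. [folklore] -/
theorem StrategyE.surfacePhaseGated_isStratumDisciplined
    (hReady : ∀ (W : Scheme.{u}) (E : Boundary W) (D : Closeds W), (D : Set W) ∈ surfaceComponents W N ν → Ready W E N ν D →
      Scheme.IsRegular (menuCentre D).subscheme)
    (hprep : ∀ (W : Scheme.{u}) (hW : IsLocallyNoetherian W) (L : Labelling W) (P : Option (Pending W)) (E : Boundary W) (D : Closeds W)
      (C : W.IdealSheafData), (D : Set W) ∈ surfaceComponents W N ν → prep W hW N ν L P E D C →
        Scheme.IsRegular C.subscheme ∧ (C.support : Set W) ⊆ Scheme.hsStratum W N ν) :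
    (StrategyE.surfacePhaseGated Ready prep G).IsStratumDisciplined N ν := by
  refine StrategyE.oldestFirst_gated_isDisciplinedBy fun W hW L P E x C P' _ hρ => ?_
  obtain ⟨D, hD, hxD, -, h⟩ := hρ
  rcases h with ⟨hR, rfl⟩ | ⟨-, hp, hxC⟩
  · exact stratumMenu_of_subset (hReady W E D hD hR) (by simpa using hxD)
      (by simpa using subset_hsStratum_of_mem_surfaceComponents hD)
  · obtain ⟨hreg, hsub⟩ := hprep W hW L P E D C hD hp
    exact stratumMenu_of_subset hreg hxC hsub

/-- **A live surface site stays live under the gate iff one of its proposals passes**; in particular (P1) is SKIPPED at a state exactly when every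
surface proposal is blocked at some live corner on its centre. [folklore] -/
theorem StrategyE.surfacePhaseGated_exists_step_iff {W : Scheme.{u}} {hW : IsLocallyNoetherian W} {L : Labelling W} {P : Option (Pending W)}
    {E : Boundary W} :
    (∃ (C : W.IdealSheafData) (P' : Option (Pending (blowup C))), (StrategyE.surfacePhaseGated Ready prep G).step W hW N ν L P E C P') ↔
      HasLiveSite ((surfaceProposal Ready prep).gated G) W hW N ν L P E :=
  StrategyE.oldestFirst_gated_exists_step_iff

end Surface

/-! ## §4. The gated (P1) tier OF RECORD and the assembly -/

section Record

variable (Ready : SurfaceReadiness.{u}) (regular : SurfaceRegularity.{u}) (phaseS : SurfacePrep.{u}) (bad : SurfaceBadness.{u})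
  (cure point : SurfacePrep.{u}) (G : CentreGate.{u}) {N : ℕ} {ν : ℕ → ℕ}

/-- [OURS · L1 W4.2] **THE GATED (P1) TIER OF RECORD**: the gated surface phase over `SurfacePrep.ofRecord` (PHASE S / cure / point by the case rule).
NOT a statement of the manuscript. [folklore] -/
def StrategyE.surfacePhaseOfRecordGated : StrategyE.{u} :=
  StrategyE.surfacePhaseGated Ready (SurfacePrep.ofRecord regular phaseS bad cure point) G

/-- Unfolding. [folklore] -/
theorem StrategyE.surfacePhaseOfRecordGated_eq :
    StrategyE.surfacePhaseOfRecordGated Ready regular phaseS bad cure point G =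
      StrategyE.surfacePhaseGated Ready (SurfacePrep.ofRecord regular phaseS bad cure point) G :=
  rfl

/-- The trivial gate gives back `surfacePhaseOfRecord`. [folklore] -/
@[simp] theorem StrategyE.surfacePhaseOfRecordGated_top :
    StrategyE.surfacePhaseOfRecordGated Ready regular phaseS bad cure point CentreGate.top =
      StrategyE.surfacePhaseOfRecord Ready regular phaseS bad cure point := by
  rw [StrategyE.surfacePhaseOfRecordGated_eq, StrategyE.surfacePhaseGated_top, StrategyE.surfacePhaseOfRecord_eq]

/-- Functional. [folklore] -/
theorem StrategyE.surfacePhaseOfRecordGated_isFunctional (N : ℕ) (ν : ℕ → ℕ) :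
    (StrategyE.surfacePhaseOfRecordGated Ready regular phaseS bad cure point G).IsFunctional N ν :=
  StrategyE.surfacePhaseGated_isFunctional _ _ _ N ν

variable {Ready regular phaseS bad cure point G}

/-- **Stratum discipline of the gated tier of record** from the readiness obligation and the three sub-oracle obligations (as for
`surfacePhaseOfRecord_isStratumDisciplined`). [folklore] -/
theorem StrategyE.surfacePhaseOfRecordGated_isStratumDisciplined
    (hReady : ∀ (W : Scheme.{u}) (E : Boundary W) (D : Closeds W), (D : Set W) ∈ surfaceComponents W N ν → Ready W E N ν D →
      Scheme.IsRegular (menuCentre D).subscheme)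
    (hS : ∀ (W : Scheme.{u}) (hW : IsLocallyNoetherian W) (L : Labelling W) (P : Option (Pending W)) (E : Boundary W) (D : Closeds W)
      (C : W.IdealSheafData), (D : Set W) ∈ surfaceComponents W N ν → ¬ regular W D → phaseS W hW N ν L P E D C →
        Scheme.IsRegular C.subscheme ∧ (C.support : Set W) ⊆ Scheme.hsStratum W N ν)
    (hcure : ∀ (W : Scheme.{u}) (hW : IsLocallyNoetherian W) (L : Labelling W) (P : Option (Pending W)) (E : Boundary W) (D : Closeds W)
      (C : W.IdealSheafData), (D : Set W) ∈ surfaceComponents W N ν → regular W D → 0 < bad W E D → cure W hW N ν L P E D C →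
        Scheme.IsRegular C.subscheme ∧ (C.support : Set W) ⊆ Scheme.hsStratum W N ν)
    (hpoint : ∀ (W : Scheme.{u}) (hW : IsLocallyNoetherian W) (L : Labelling W) (P : Option (Pending W)) (E : Boundary W) (D : Closeds W)
      (C : W.IdealSheafData), (D : Set W) ∈ surfaceComponents W N ν → regular W D → bad W E D = 0 → point W hW N ν L P E D C →
        Scheme.IsRegular C.subscheme ∧ (C.support : Set W) ⊆ Scheme.hsStratum W N ν) :
    (StrategyE.surfacePhaseOfRecordGated Ready regular phaseS bad cure point G).IsStratumDisciplined N ν :=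
  StrategyE.surfacePhaseGated_isStratumDisciplined hReady (SurfacePrep.ofRecord_regular_subset hS hcure hpoint)

/-- **THE ASSEMBLY WITH THE GATE keeps its shape**: `betweenCycles (policyOfRecord π₁ π₂ π₃)` with `π₁ :=` the gated (P1) tier is stratum-disciplined as
soon as the three tiers are (`IsStratumDisciplined.policyOfRecord`, `.betweenCycles`). [folklore] -/
theorem StrategyE.IsStratumDisciplined.betweenCycles_policyOfRecord {π₁ π₂ π₃ : StrategyE.{u}} (h₁ : π₁.IsStratumDisciplined N ν)
    (h₂ : π₂.IsStratumDisciplined N ν) (h₃ : π₃.IsStratumDisciplined N ν) :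
    (StrategyE.policyOfRecord π₁ π₂ π₃).betweenCycles.IsStratumDisciplined N ν :=
  (h₁.policyOfRecord h₂ h₃).betweenCycles

end Record

end Summit.ResolutionOfSingularities.ResolutionOfSingularities.Theorems.SigmaMaxModificationsCorridor3.Sigma

end
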